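import Literature.MathematicalPhysics.QuantumFieldTheory.ConformalBootstrap3D.PointKernelK34v2Data
import Literature.MathematicalPhysics.QuantumFieldTheory.ConformalBootstrap3D.PointKernelParts

/-!
# K34v2 certificate, kernel part file P7: one-cell head segments 99, 100 in level ranges

The head cells whose kernel evaluation exceeds one `decide` are one-cell segments of `hsegsK34v2`; each is
checked by `PCert.hPartSideOK` (side conditions) and `PCert.hPartOK` per level range `[n_lo, n_lo + count)`
against an integer claim, the claims summing to `≥ 0` (`PointKernel.partsOK`); soundness is
`PCert.hParts_sound` (`PointKernelParts`).  The part files `P1, P2, …` are mutually independent (each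
imports only the data file); the ranges of one cell may span several of them, and the per-cell
conclusions `hparts_i` / `hcell_i` of those cells are assembled in `PointKernelK34v2.lean`.
Estimated kernel time 214 s.
-/

set_option maxRecDepth 100000
set_option maxHeartbeats 0

namespace Literature.MathematicalPhysics.QuantumFieldTheory.ConformalBootstrap3D.PointKernelK34v2

open Literature.MathematicalPhysics.QuantumFieldTheory.ConformalBootstrap3D.PointKernel

/-- levels `[56, 61)` of segment 99: partial lower sum `≥` claim. [folklore] -/
theorem part_99_4 : certK34v2.hPartOK (PCert.segAt hsegsK34v2 99) JHK34v2 56 5 (74766867580692658294320988608701384) = true := by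
  decide +kernel

/-- levels `[61, 66)` of segment 99: partial lower sum `≥` claim. [folklore] -/
theorem part_99_5 : certK34v2.hPartOK (PCert.segAt hsegsK34v2 99) JHK34v2 61 5 (38493482678774461887044978279805928) = true := by
  decide +kernel

/-- levels `[66, 67)` of segment 99: partial lower sum `≥` claim. [folklore] -/
theorem part_99_6 : certK34v2.hPartOK (PCert.segAt hsegsK34v2 99) JHK34v2 66 1 (-951602157413080025341397268061819) = true := by
  decide +kernel

/-- one-cell segment 100 (row 4, cell `[2561/512, 5123/1024]`, chord, `n_F = 58`,
4 level ranges): side conditions. [folklore] -/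
theorem pside_100 : certK34v2.hPartSideOK (PCert.segAt hsegsK34v2 100) JHK34v2 = true := by
  decide +kernel

/-- its level ranges `(n_lo, count, claim)`. [folklore] -/
def parts_100 : List (ℕ × ℕ × ℤ) := [(0, 31, -2862119336082247030922036585571671782), (31, 12, 2214396909509204760790406609998298590), (43, 9, 512141347082374247594983966218382358), (52, 7, 135581079490668022536646009354990836)]

/-- the ranges tile `[0, n_F]` and the claims sum to `≥ 0`. [folklore] -/
theorem pcov_100 : PointKernel.partsOK 58 parts_100 = true := by
  decide +kernel

/-- levels `[0, 31)` of segment 100: partial lower sum `≥` claim. [folklore] -/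
theorem part_100_0 : certK34v2.hPartOK (PCert.segAt hsegsK34v2 100) JHK34v2 0 31 (-2862119336082247030922036585571671782) = true := by
  decide +kernel

end Literature.MathematicalPhysics.QuantumFieldTheory.ConformalBootstrap3D.PointKernelK34v2
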